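import Summits.CriticalPhenomena.PercolationContinuityZ3.Theorems.PercNearOneGluingNoHeavyLowerTailSahiGoodAxisFalse
import Summits.CriticalPhenomena.PercolationContinuityZ3.Theorems.PercNearOneGluingNoHeavyLowerTailSahiGoodAxisForced
import Summits.CriticalPhenomena.PercolationContinuityZ3.Theorems.PercNearOneGluingNoHeavyLowerTailSahiSliceMinimumBernstein

/-!
# `NoHeavyLowerTail` (crux stmt-CriticalPhenomena-4575), Sahi programme P2 (gen 16): the SLICE AXIS in the determining-set
# format of the (refuted) good-axis conjecture, and its UNIFORM version — the axis can be chosen from the triple alone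

Support file (`--supports stmt-CriticalPhenomena-4575`; companion of `…SahiSliceMinimum` (the slice minimum principle SMP),
`…SahiGoodAxis` / `…SahiGoodAxisFalse` (bnk-2's chord version GA, refuted by `not_goodAxis`)).

* `SliceAxis` (@[conjecture]) — GA with the AVERAGE of the two sectional values replaced by their MINIMUM: for every product
  measure `μ_q`, every triple of increasing events and every nonempty determining set `S`, SOME `a ∈ S` has
  `min(Φ_a(1), Φ_a(0)) ≤ Φ_a(q_a) = E_3(U)`.  This is the slice minimum principle of `…SahiSliceMinimum` in bnk-2's format (there:
  'some LIVE coin'; here: 'some coin of any determining set' — a coin on which no event depends satisfies it with equality, so the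
  content sits in the minimal determining set).  `masterFamilyNonneg_three_of_sliceAxis`, `kahnConjecture_of_sliceAxis`: it implies
  Kahn's Conjecture 5 by bnk-2's induction on `|S|` (both sections are increasing and determined by `S ∖ {a}`).  It survives every
  refuter of GA (doubled / blown-up stars: their top facets vanish, `min = 0 ≤ E_3`), and is census-clean: `k ≤ 4` exhaustive × many
  `q`, **`k = 5` EXHAUSTIVE (all 7.26·10¹⁰ triples) × 6 measures (kit j153426): 0 failures**, `k = 6, 7` random 2.4·10⁷, structured
  families, adversarial searches (memo FROM-prim-masterthm-p2-g16-SLICE-MINIMUM-PRINCIPLE.md).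
* `UniformSliceAxis` (a definition, NOT a conjecture: it is FALSE from five coins on, `SahiUniformAxisFalse.not_uniformSliceAxis` in
  the companion file `…SahiSliceMinimumUniformAxisFalse`) — 'the axis can be chosen BEFORE the measure': for every triple and every
  nonempty determining `S`, ONE `a ∈ S` with `min(Φ_a(1), Φ_a(0)) ≤ Φ_a(q_a)` for ALL `q`.  It holds for every triple on `≤ 4` coins
  over large random panels of measures (`{0,1}³`: 1540 triples × 400 q; `{0,1}⁴` EXHAUSTIVE: 804 440 triples × 300 q, two seeds;
  histogram of the number of uniformly good axes 1:9 / 2:3032 / 3:41 658 / 4:759 741), for all rotation- and swap-symmetric classes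
  tested (`k ≤ 9`), and PROVABLY for every triple with a forced coordinate (`uniformSliceAxis_of_forced`, from bnk-2's
  `chord_le_cubicE3_of_forced`); a hill-climbing adversary restricted to triples WITHOUT forced coordinates refutes it at `k = 5`
  (memo §7: `A = ↑{x₀, x₃x₄}`, `B = ↑{x₀x₁,x₁x₃,x₁x₄,x₂x₄,x₃x₄}`, `C = ↑{x₀x₂,x₁x₂,x₁x₃,x₂x₃,x₁x₄,x₂x₄,x₀x₃x₄}`, five
  measures with denominator 20).  So the slice axis of SMP genuinely depends on the measure; recorded here because the dichotomy 'forced coordinate ⟹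
  uniform axis / no forced coordinate ⟹ measure-dependent axis' is the sharpest structural information on SMP so far.
HONEST LABEL: one conjecture (`SliceAxis`) typed with its kernel-checked reduction to Kahn's Conjecture 5, one natural strengthening
(`UniformSliceAxis`) defined, reduced, proved on a class and refuted in general (companion file); Kahn's `C_3` remains OPEN. [this work]
-/

noncomputable section

open scoped Classical

namespace Summit.CriticalPhenomena.PercolationContinuityZ3.Theorems

open Finset Function
open Literature.Combinatorics.Sahi2008
open Literature.Probability.LatticeModels (prodBernoulli)
open Literature.Probability.Percolation (DeterminedBy determinedBy_iff)
open Literature.Probability.Percolation.DecisionTree (ind ind_of_mem ind_of_not_mem ind_nonneg)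
open SahiComb SahiLogDerivEnd SahiTwoLevel SahiGoodAxis

namespace SahiSliceMinimum

/-- **Conjecture SLICE-AXIS** (the slice minimum principle in determining-set format): for every finite cube, every product measure
`μ_q`, every triple of increasing events and every NONEMPTY determining set `S`, SOME `a ∈ S` has
`min(Φ_a(1), Φ_a(0)) ≤ Φ_a(q_a)`, i.e. `E_3(U) ≥ min(E_3(U^{a←1}), E_3(U^{a←0}))` — along some axis `E_3` is at least the
SMALLER of its two sectional values (GA asked for the average and is false, `SahiGoodAxisFalse.not_goodAxis`).  Implies Kahn's
Conjecture 5 (`kahnConjecture_of_sliceAxis`).  OPEN; an obligation, never a fact. [this work] [status: open; conjecture] -/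
@[conjecture] def SliceAxis : Prop :=
  ∀ (κ : Type) [Fintype κ] (q : κ → unitInterval) (U : Fin 3 → Set (Set κ)), (∀ i, IsUpperSet (U i)) →
    ∀ S : Finset κ, S.Nonempty → (∀ i, DeterminedBy (U i) (↑S : Set κ)) →
      ∃ a ∈ S, min (cubicE3 q a (ind (U 0)) (ind (U 1)) (ind (U 2)) 1) (cubicE3 q a (ind (U 0)) (ind (U 1)) (ind (U 2)) 0)
        ≤ cubicE3 q a (ind (U 0)) (ind (U 1)) (ind (U 2)) (q a)

/-- **UNIFORM-SLICE-AXIS** (definition; FALSE in general — `SahiUniformAxisFalse.not_uniformSliceAxis`; true on `≤ 4` coins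
(census) and for triples with a forced coordinate (`uniformSliceAxis_of_forced`)): the slice axis can be chosen from the TRIPLE
ALONE — for every triple of increasing events and every nonempty determining set `S` there is ONE `a ∈ S` such that
`min(Φ_a(1), Φ_a(0)) ≤ Φ_a(q_a)` for EVERY product measure `μ_q`.  Implies `SliceAxis` (`sliceAxis_of_uniformSliceAxis`).
[this work] [status: refuted for |S| ≥ 5; kept as a tagged statement so that its refutation and
its proved sub-cases have a named target] -/
@[conjecture] def UniformSliceAxis : Prop :=
  ∀ (κ : Type) [Fintype κ] (U : Fin 3 → Set (Set κ)), (∀ i, IsUpperSet (U i)) →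
    ∀ S : Finset κ, S.Nonempty → (∀ i, DeterminedBy (U i) (↑S : Set κ)) →
      ∃ a ∈ S, ∀ q : κ → unitInterval,
        min (cubicE3 q a (ind (U 0)) (ind (U 1)) (ind (U 2)) 1) (cubicE3 q a (ind (U 0)) (ind (U 1)) (ind (U 2)) 0)
          ≤ cubicE3 q a (ind (U 0)) (ind (U 1)) (ind (U 2)) (q a)

/-- The uniform version implies the pointwise one. [this work] -/
theorem sliceAxis_of_uniformSliceAxis (h : UniformSliceAxis) : SliceAxis := by
  intro κ _ q U hU S hS hdet
  obtain ⟨a, haS, ha⟩ := h κ U hU S hS hdet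
  exact ⟨a, haS, ha q⟩

section Induction

variable {κ : Type} [Fintype κ]

/-- **The induction on a determining set** (bnk-2's scheme with the minimum in place of the average): under `SliceAxis`, every
triple of increasing events determined by a finite set `S` has `E_3(μ_q; 1_U) ≥ 0` for every product measure `q`.  Step: pick
the slice axis `a ∈ S`; both sections are increasing and determined by `S ∖ {a}`, so
`E_3(U) ≥ min(E_3(U^{a←1}), E_3(U^{a←0})) ≥ 0`. [this work] -/
theorem sahiE_three_nonneg_of_determinedBy_slice (hSA : SliceAxis) :
    ∀ (n : ℕ) (S : Finset κ), S.card ≤ n → ∀ (U : Fin 3 → Set (Set κ)), (∀ i, IsUpperSet (U i)) →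
      (∀ i, DeterminedBy (U i) (↑S : Set κ)) → ∀ q : κ → unitInterval, 0 ≤ sahiE (bernoulliWeight q) 3 (fun i => ind (U i)) := by
  intro n
  induction n with
  | zero =>
    intro S hS U _ hUd q
    have hS0 : S = ∅ := Finset.card_eq_zero.1 (Nat.le_zero.1 hS)
    subst hS0
    rw [sahiE_bernoulliWeight_eq_sum_combCoeff]
    exact sum_nonneg fun j _ => mul_nonneg
      (combCoeff_ind_nonneg_of_trivial U (fun i => eq_empty_or_univ_of_determinedBy_empty (hUd i)) j) (bern_nonneg _ _ _)
  | succ n ih =>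
    intro S hS U hU hUd q
    by_cases hne : S.Nonempty
    · obtain ⟨a, haS, hgood⟩ := hSA κ q U hU S hne hUd
      have hcard : (S.erase a).card ≤ n := by
        rw [card_erase_of_mem haS]
        omega
      have hsec : ∀ (b : Bool) (i : Fin 3), DeterminedBy (secAt a b (U i)) (↑(S.erase a) : Set κ) :=
        fun b i => determinedBy_secAt a b (hUd i)
      have h1 : 0 ≤ cubicE3 q a (ind (U 0)) (ind (U 1)) (ind (U 2)) 1 := by
        rw [FibreCubic.cubicE3_one_eq_secAt]
        exact ih (S.erase a) hcard _ (fun i => isUpperSet_secAt a true (hU i)) (hsec true) q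
      have h0 : 0 ≤ cubicE3 q a (ind (U 0)) (ind (U 1)) (ind (U 2)) 0 := by
        rw [cubicE3_zero_eq_secAt]
        exact ih (S.erase a) hcard _ (fun i => isUpperSet_secAt a false (hU i)) (hsec false) q
      rw [← cubicE3_self_eq q a U]
      exact le_trans (le_min h1 h0) hgood
    · have hS0 : S = ∅ := Finset.not_nonempty_iff_eq_empty.1 hne
      subst hS0
      exact ih ∅ (by simp) U hU hUd q

end Induction

/-- **SLICE-AXIS ⟹ Sahi's `C_3` on product measures** (`MasterFamilyNonneg 3`, Kahn's Conjecture 5). [this work] -/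
theorem masterFamilyNonneg_three_of_sliceAxis (hSA : SliceAxis) : MasterFamilyNonneg 3 := by
  intro ι _ p U hU
  exact sahiE_three_nonneg_of_determinedBy_slice hSA (Finset.univ : Finset ι).card Finset.univ le_rfl U hU
    (fun j => determinedBy_coe_univ _) p

/-- **SLICE-AXIS ⟹ Kahn's Conjecture 5.** [this work] -/
theorem kahnConjecture_of_sliceAxis (hSA : SliceAxis) : KahnConjecture :=
  masterFamilyNonneg_three_iff_kahnConjecture.1 (masterFamilyNonneg_three_of_sliceAxis hSA)

/-- UNIFORM-SLICE-AXIS would imply Kahn's Conjecture 5 (moot in general — it is false from five coins on — but it records the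
reduction used on the classes where it holds). [this work] -/
theorem kahnConjecture_of_uniformSliceAxis (h : UniformSliceAxis) : KahnConjecture :=
  kahnConjecture_of_sliceAxis (sliceAxis_of_uniformSliceAxis h)

/-- A convex combination of two numbers dominates their minimum. [folklore] -/
theorem min_le_chord {t x y : ℝ} (ht0 : 0 ≤ t) (ht1 : t ≤ 1) : min x y ≤ t * x + (1 - t) * y := by
  have hx : min x y ≤ x := min_le_left _ _
  have hy : min x y ≤ y := min_le_right _ _
  nlinarith [mul_le_mul_of_nonneg_left hx ht0, mul_le_mul_of_nonneg_left hy (sub_nonneg.2 ht1)]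

/-- The refuted chord version would have implied the slice version (an average dominates the minimum): `GoodAxis → SliceAxis`.
Recorded to place the two conjectures: GA (false) ⟹ SLICE-AXIS (open) ⟹ Kahn. [this work] -/
theorem sliceAxis_of_goodAxis (hGA : GoodAxis) : SliceAxis := by
  intro κ _ q U hU S hS hdet
  obtain ⟨a, haS, hgood⟩ := hGA κ q U hU S hS hdet
  exact ⟨a, haS, le_trans (min_le_chord (q a).2.1 (q a).2.2) hgood⟩

/-! ### A proved instance: a FORCED coordinate is a uniform slice axis -/

/-- **A coordinate forced for one of the events is a slice axis for EVERY product measure** (bnk-2's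
`SahiGoodAxisForced.chord_le_cubicE3_of_forced` gives even the chord inequality there): if `U 0 ⊆ {ω | a ∈ ω}` then
`min(Φ_a(1), Φ_a(0)) ≤ Φ_a(q_a)` for all `q`. [this work] -/
theorem slice_at_forced {κ : Type} [Fintype κ] (q : κ → unitInterval) (a : κ) (U : Fin 3 → Set (Set κ))
    (h0 : U 0 ⊆ {ω | a ∈ ω}) (hU : ∀ i, IsUpperSet (U i)) :
    min (cubicE3 q a (ind (U 0)) (ind (U 1)) (ind (U 2)) 1) (cubicE3 q a (ind (U 0)) (ind (U 1)) (ind (U 2)) 0)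
      ≤ cubicE3 q a (ind (U 0)) (ind (U 1)) (ind (U 2)) (q a) :=
  le_trans (min_le_chord (q a).2.1 (q a).2.2)
    (SahiGoodAxisForced.chord_le_cubicE3_of_forced q a U h0 (hU 1) (hU 2) (hU 0))

/-- **UNIFORM-SLICE-AXIS holds for every triple whose first event has a forced coordinate in `S`** (e.g. a principal up-set
`↑T`, `T ∩ S ≠ ∅`): that coordinate is a uniform slice axis. [this work] -/
theorem uniformSliceAxis_of_forced {κ : Type} [Fintype κ] (U : Fin 3 → Set (Set κ)) (hU : ∀ i, IsUpperSet (U i))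
    (S : Finset κ) {a : κ} (haS : a ∈ S) (h0 : U 0 ⊆ {ω | a ∈ ω}) :
    ∃ a ∈ S, ∀ q : κ → unitInterval,
      min (cubicE3 q a (ind (U 0)) (ind (U 1)) (ind (U 2)) 1) (cubicE3 q a (ind (U 0)) (ind (U 1)) (ind (U 2)) 0)
        ≤ cubicE3 q a (ind (U 0)) (ind (U 1)) (ind (U 2)) (q a) :=
  ⟨a, haS, fun q => slice_at_forced q a U h0 hU⟩

/-- **The doubled star that refutes GA satisfies SLICE-AXIS at the same point** (indeed with room: the top facet vanishes):
for every axis `a` of `SahiGoodAxisFalse.dsU` at `q ≡ 3/5`, `min(Φ_a(1), Φ_a(0)) = 0 ≤ Φ_a(q_a) = 4407346944/5¹⁸`. [this work] -/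
theorem sliceAxis_holds_on_doubledStar (a : Fin 6) :
    min (cubicE3 SahiGoodAxisFalse.q35 a (ind SahiGoodAxisFalse.dsA) (ind SahiGoodAxisFalse.dsB) (ind SahiGoodAxisFalse.dsC) 1)
        (cubicE3 SahiGoodAxisFalse.q35 a (ind SahiGoodAxisFalse.dsA) (ind SahiGoodAxisFalse.dsB) (ind SahiGoodAxisFalse.dsC) 0)
      ≤ cubicE3 SahiGoodAxisFalse.q35 a (ind SahiGoodAxisFalse.dsA) (ind SahiGoodAxisFalse.dsB) (ind SahiGoodAxisFalse.dsC)
          (SahiGoodAxisFalse.q35 a) := by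
  obtain ⟨h1, h0, hq⟩ := SahiGoodAxisFalse.cubicE3_values a
  rw [h1, h0, hq]
  norm_num

end SahiSliceMinimum

end Summit.CriticalPhenomena.PercolationContinuityZ3.Theorems
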